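/-
Origin: expansion seat `planner-pub-hodgecm-qw8-g11-0`, handover #23 SPLIT PART 4/4 = REPLACE tree `HodgeCM/Model/Toy/LefQuartic.lean` 7081025a (1140 l.) by md5 2ee64831c2e2843a0ddf4d8b1323ee25 (270 l.): keeps the module name + module docstring, its earlier sections moved verbatim to rows #20..#22 (LefQuarticSign, LefQuarticTwist, LefQuarticInner); ONE rewrite: `import Qw8g11.LefQuarticInner` -> `import HodgeCM.Model.Toy.LefQuarticInner` (row #22); union of the (`HOME/pub-hodgecm-qw8-g11/lean/Qw8g11/LefQuartic.lean`, md5 2ee64831, 270 lines);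
landed by the packager successor (mc-unitary-1-g3, gen-8 kit) in gate run 32 REPLACES the earlier landed copy of `HodgeCM/Model/Toy/LefQuartic.lean` (import ^import Qw8g11\.LefQuarticInner[ \t]*$→import HodgeCM.Model.Toy.LefQuarticInner ×1).
-/
-- HANDOVER (planner-pub-hodgecm-qw8-g11-0, unit pub-hodgecm-qw8-g11): SPLIT PART 4/4 = REPLACEMENT of the installed
-- `HodgeCM.Model.Toy.LefQuartic` (md5 7081025a, 1140 l.): §§9–11 (ll. 951–1136) verbatim + docstrings; §§1–8 moved to
-- `LefQuarticSign` / `LefQuarticTwist` / `LefQuarticInner`; at landing rewrite `import Qw8g11.LefQuarticInner` ↦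
-- `import HodgeCM.Model.Toy.LefQuarticInner` (lands AFTER the three parts).
/-
Copyright: pub-hodgecm cell (HodgeCMPerL). Separating-model layer (gen 8 of the [QW8] §2.5 lineage). New file.
-/
import Summits.HodgeConjecture.HodgeCM.Model.Toy.LefQuarticInner

/-!
# The Lefschetz model in CM degree at most four: every Hodge class is algebraic

(Split for the 400-line cap: §§1–4 are now `HodgeCM.Model.Toy.LefQuarticSign`, §§5–7a `HodgeCM.Model.Toy.LefQuarticTwist`,
§§7b–8 `HodgeCM.Model.Toy.LefQuarticInner` — an import chain ending here; §§9–11 below are unchanged and this docstring still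
describes the whole.)

`LefWitness` / `LefDegree4` located the failure of `HC_CM` in the Lefschetz model `lefModel` (the exterior
CM-model with `Alg := Hdg ∩ Bal`) exactly on the Weil LINES: the Weil line of a face of a CM field `K` is
`lefModel`-algebraic iff `[K:ℚ] = 4`.  Here we settle the WHOLE SECTOR OF CM DEGREE `≤ 4`, in every
cohomological degree and for arbitrary products.

HEADLINE `lef_hc_cmProd_of_finrank_eq_four` / `lef_hc_cmProd_of_finrank_le_four`: for a CM field `K` with
`[K:ℚ] ≤ 4` (imaginary quadratic, or quartic — Galois or not) and any finite family of CM types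
`Φ₀, …, Φₙ` of `K` (repetitions allowed), `lefModel ⊨ HC(A_{(K,Φ₀)} × ⋯ × A_{(K,Φₙ)})`: every Hodge class
of every degree `2p` is `lefModel`-algebraic (`lef_hc_of_presented`, `lef_hc_of_presented_of_finrank_le_four`
for any object presented over `K`; `lef_hc_cmObj_of_finrank_eq_four/le_four`; `lef_hc_PP_of_finrank_eq_four`
for the four-fold Weil product).  So inside `lefModel` the Hodge conjecture for CM abelian varieties HOLDS
in CM degree `≤ 4` and FAILS from degree six on (`not_hc_cm_lefModel`): the separating model draws its line
exactly where Weil classes with pairwise non-complementary corner types appear.  §10 records the boundary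
as an equivalence, `lef_hc_cmProd_iff_finrank_le_four`: ALL products of CM abelian varieties with CM types
from `K` satisfy HC in `lefModel` **iff** `[K:ℚ] ≤ 4` (the converse is the corner product of any face,
`exists_face` + `not_lef_hc_PP_face`, i.e. gen 6's unbalanced Weil class `δ(1)` over an arbitrary face);
§11 widens the positive side to products `A_{(F₀,Φ₀)} × ⋯ × A_{(Fₙ,Φₙ)}` over ARBITRARY CM fields `Fᵢ ⊇ K`
whose types are induced from one `K` of degree `≤ 4` (`induceType`, `lef_hc_prodFin_induceType`).

The proof has an analytic half and a combinatorial half.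

* §1 (any object, any degree) `Obj.hodgeClasses_bal_of_cntBal`: a RATIONAL class of Hodge type `(p,p)` has
  non-zero wedge-basis coordinates only at index sets `S` all of whose Galois translates `γ • S` have
  exactly `p` holomorphic slots (`Obj.cnt_gact_eq_of_repr_ne_zero`: Galois permutes the coordinates of a
  rational class, `LefLefschetz.D_theta_gact`, while `F^p` and `F̄^p` bound the count from both sides).
  Hence `Hdg^{2p} ⊆ Θ⁻¹ Bal^{2p}` as soon as `X.CntBal` := "constant holomorphy count under Galois ⇒
  balanced" — the generalisation of the model's Lefschetz (1,1) (`Obj.lefschetz11_bal`) to all degrees.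
* §§2–8 (one CM field of degree `≤ 4`) `Obj.cntBal_of_presented(_of_finrank_le_four)`: `CntBal` holds for
  every object whose atoms are `(K, Ψ_i)` for CM types `Ψ_i` of ONE CM field `K` with `[K:ℚ] ≤ 4`.  Read slot `j` of an index map as a pair
  `(σ_j, Ψ_j)` with `σ_j ∈ Hom(K,ℂ)`; its Galois type is `T_j = {γ | γσ_j ∈ Ψ_j}` and its SIGN VECTOR is
  `ψ_j(f) = sgn_{Ψ_j}(f σ_j) = ±1` on the finite set `Ω_K ⊆ Sym(Hom(K,ℂ))` of permutations induced by
  `Aut_ℚ(ℚ̄)` (§6 — no quotient of the Galois group is formed: all sums run over `Ω_K` and its one- and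
  two-slot images, which are HOMOGENEOUS, §5 being orbit–stabiliser for a transitive family of injections).
  Constant count makes `Σ_j ψ_j` constant on `Ω_K`, each `ψ_l` has mean zero, so `Σ_j ⟨ψ_j, ψ_l⟩ = 0`; and
  in CM degree `≤ 4` every inner product `⟨ψ_j, ψ_l⟩` is `0` or `±#Ω_K` (§7, the trichotomy `TriInner K`:
  for a quartic field the embeddings are `x, x̄, z, z̄` and the pair orbit of two embeddings over different
  places has `4` or `8` elements, `tri_inner`; for an imaginary quadratic field all slots lie over the one
  place, `triInner_of_finrank_eq_two`), with `+#Ω_K` iff `T_j = T_l` and `-#Ω_K` iff `T_j = T_lᶜ` (§4).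
  Summing over `j`: `#{j : T_j = T} = #{j : T_j = Tᶜ}` for every type `T`, which is balance.

Why degree at most four: with `≤ 4` embeddings a sign vector is determined up to sign by its place, and two
places interact through a single small pair orbit; from degree six on the inner products are no longer `0`
or extremal (the unbalanced Weil generators `r σ` of `LefWitness`).
Nothing here is cited: kernel facts about an explicit model.
-/

noncomputable section

set_option backward.isDefEq.respectTransparency false

namespace HodgeCM.Toy

open scoped TensorProduct
open exteriorPower Module CMPresentation CMTypeOps
open NumberField.ComplexEmbedding (conjugate)
open Literature.AlgebraicGeometry.Motives
open Literature.AlgebraicGeometry.Motives.HodgeStructure (ofRat ofRat_apply mem_hodgeClasses_iff)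
open Literature.AlgebraicGeometry.ShimuraVarieties (conjRingHomK embedding_conjRingHomK)

/-! ### 9. HEADLINE: the Lefschetz model satisfies the Hodge conjecture in CM degree ≤ 4 -/

section Headline

variable (K : CMField)

/-- `A_{(K,Φ)} = cmObj K Φ` is presented over `K` -/
theorem presented_cmObj (Φ : CMType K) : (cmObj K Φ).Presented K :=
  ⟨fun _ => Φ, fun _ => (eK K : K →+* FK K), fun _ _ => Iff.rfl⟩

/-- `Presented K` is preserved by the product `X.prod Y` -/
theorem presented_prod {X Y : Obj} (hX : X.Presented K) (hY : Y.Presented K) : (X.prod Y).Presented K := by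
  obtain ⟨Ψ, e, he⟩ := hX
  obtain ⟨Ψ', e', he'⟩ := hY
  refine ⟨Sum.elim Ψ Ψ', fun i => match i with | .inl i => e i | .inr i => e' i, ?_⟩
  rintro (i | i) τ
  · exact he i τ
  · exact he' i τ

/-- `Presented K` is preserved by the iterated product `prodFin` of `toyModelWith D` -/
theorem presented_prodFin (D : HodgeData) : ∀ (n : ℕ) (X : Fin (n + 1) → Obj), (∀ j, (X j).Presented K) →
    Obj.Presented K ((toyModelWith D).prodFin n X)
  | 0, _, h => h 0
  | n + 1, _, h => presented_prod K (presented_prodFin D n _ fun _ => h _) (h _)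

/-- the CM product `A_{(K,Φ₀)} × ⋯ × A_{(K,Φₙ)}` is presented over `K` -/
theorem presented_cmProd (D : HodgeData) {n : ℕ} (Φ : Fin (n + 1) → CMType K) :
    Obj.Presented K ((toyModelWith D).cmProd K Φ) :=
  presented_prodFin K D n _ fun j => presented_cmObj K (Φ j)

/-- **`CntBal ⇒ HC` in the Lefschetz model** (any object): `Hdg^{2p}(X) ⊆ Hdg^{2p}(X) ∩ Bal^{2p}(X) = Alg_lef`. -/
theorem lef_hc_of_cntBal (X : Obj) (hX : X.CntBal) : lefModel.HC X := by
  intro p x hx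
  rw [mem_lef_alg]
  exact ⟨hx, X.hodgeClasses_bal_of_cntBal hX p x hx⟩

/-- **CM degree at most four.** In the Lefschetz model every Hodge class on every object presented over ONE
CM field `K` with `[K:ℚ] ≤ 4` (imaginary quadratic or quartic) is algebraic … -/
theorem lef_hc_of_presented_of_finrank_le_four (hK : Module.finrank ℚ K ≤ 4) (X : Obj)
    (hX : X.Presented K) : lefModel.HC X :=
  lef_hc_of_cntBal X (X.cntBal_of_presented_of_finrank_le_four K hK hX)

/-- … in particular on `A_{(K,Φ₀)} × ⋯ × A_{(K,Φₙ)}` for any CM types `Φ₀, …, Φₙ` of such a `K` (for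
`[K:ℚ] = 2` these are the powers `Eⁿ⁺¹` of a CM elliptic curve in the model) … -/
theorem lef_hc_cmProd_of_finrank_le_four (hK : Module.finrank ℚ K ≤ 4) {n : ℕ}
    (Φ : Fin (n + 1) → CMType K) : lefModel.HC (lefModel.cmProd K Φ) := by
  rw [lefModel_eq, Universe.balMod_cmProd]
  exact lef_hc_of_presented_of_finrank_le_four K hK _ (presented_cmProd K exteriorHodgeData Φ)

/-- … and on a single `A_{(K,Φ)}`. -/
theorem lef_hc_cmObj_of_finrank_le_four (hK : Module.finrank ℚ K ≤ 4) (Φ : CMType K) :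
    lefModel.HC (cmObj K Φ) :=
  lef_hc_of_presented_of_finrank_le_four K hK _ (presented_cmObj K Φ)


variable (hK : Module.finrank ℚ K = 4)
include hK

/-- **HC in the Lefschetz model for every object presented over a quartic CM field** (any shape, any
number of factors, any `extra`). -/
theorem lef_hc_of_presented (X : Obj) (hX : X.Presented K) : lefModel.HC X :=
  lef_hc_of_cntBal X (X.cntBal_of_presented K hK hX)

/-- **HEADLINE. The Lefschetz model satisfies the Hodge conjecture on the whole quartic sector**: for a
quartic CM field `K` and ANY finite family of CM types `Φ₀, …, Φₙ` of `K` (repetitions allowed), every Hodge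
class of every degree on `A_{(K,Φ₀)} × ⋯ × A_{(K,Φₙ)}` is `lefModel`-algebraic. Complements
`lef_weilFaceAlgebraic_iff_finrank_eq_four` (the Weil LINE of a quartic face is algebraic) and
`not_hc_cm_lefModel` (HC_CM fails in `lefModel`, in degree `≥ 6`); the imaginary-quadratic sector rides
along in `lef_hc_cmProd_of_finrank_le_four`. -/
theorem lef_hc_cmProd_of_finrank_eq_four {n : ℕ} (Φ : Fin (n + 1) → CMType K) :
    lefModel.HC (lefModel.cmProd K Φ) := by
  rw [lefModel_eq, Universe.balMod_cmProd]
  exact lef_hc_of_presented K hK _ (presented_cmProd K exteriorHodgeData Φ)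

/-- in particular every Hodge class of every degree on a CM abelian variety `A_{(K,Φ)}` with `[K:ℚ] = 4` is
`lefModel`-algebraic … -/
theorem lef_hc_cmObj_of_finrank_eq_four (Φ : CMType K) : lefModel.HC (cmObj K Φ) :=
  lef_hc_of_presented K hK _ (presented_cmObj K Φ)

/-- … and so is every Hodge class on the four-fold Weil product `P = A_{Φ₁} × A_{Φ₂} × A_{Φ₃} × A_{Φ₄}` of
four CM types of a quartic `K` (all of `Hdg^•(P)`, not only the Weil line of
`lef_weilFaceAlgebraic_of_finrank_eq_four`). -/
theorem lef_hc_PP_of_finrank_eq_four (Φ : Fin 4 → CMType K) : lefModel.HC (PP K Φ) :=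
  lef_hc_of_presented K hK _ (presented_cmProd K exteriorHodgeData Φ)

end Headline

/-! ### 10. The converse, and the boundary exactly -/

section Boundary

open NumberField NumberField.InfinitePlace in
/-- a CM field of degree `> 4` has degree `≥ 6` (the degree of a CM field is even) -/
theorem six_le_finrank_of_four_lt (K : CMField) (hK : 4 < Module.finrank ℚ K) :
    6 ≤ Module.finrank ℚ K := by
  have h1 := card_add_two_mul_card_eq_rank K
  have h2 : nrRealPlaces K = 0 := IsTotallyComplex.nrRealPlaces_eq_zero K
  omega

/-- **HC fails in the Lefschetz model on the corner product `P(f) = A_{Φ₁} × A_{Φ₂} × A_{Φ₃} × A_{Φ₄}` of every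
face `f` of a CM field of degree `> 4`**: the Weil class `δ(1) ∈ W_K(P(f))` is a rational Hodge class
(M16 `fact_weilLine_hodge`) and is not balanced (gen 6 `delta_one_not_mem_balQ_face`). This is gen 6's
`not_hc_P7_lefModel` for an arbitrary face in place of the face `f7` of `ℚ(ζ₇)`. -/
theorem not_lef_hc_PP_face (K : CMField) (f : Face K) (h4 : 4 < Module.finrank ℚ K) :
    ¬ lefModel.HC (PP K f.corner) := fun h => by
  have hx : delta exteriorHodgeData K f.corner 1 ∈ lefModel.alg (PP K f.corner) 2 := by
    refine h 2 ?_
    rw [lef_hodgeClassesOf]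
    exact fact_weilLine_hodge exteriorHodgeData K f (delta_mem exteriorHodgeData K f.corner 1)
  rw [lef_alg_eq] at hx
  have h2 := (Submodule.mem_inf.mp hx).2
  change delta exteriorHodgeData K f.corner 1 ∈ (PP K f.corner).balQ 4 at h2
  exact delta_one_not_mem_balQ_face exteriorHodgeData K f h4 h2

/-- from CM degree six on, some product of CM abelian varieties from `K` (the corner product of any face)
violates HC in the Lefschetz model -/
theorem exists_not_lef_hc_cmProd (K : CMField) (h4 : 4 < Module.finrank ℚ K) :
    ∃ Φ : Fin 4 → CMType K, ¬ lefModel.HC (lefModel.cmProd K Φ) := by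
  obtain ⟨f⟩ := exists_face K (six_le_finrank_of_four_lt K h4)
  exact ⟨f.corner, not_lef_hc_PP_face K f h4⟩

/-- **HEADLINE (the HC_CM boundary of the Lefschetz model, exactly).** For a CM field `K`, the following are
equivalent: (i) every product `A_{(K,Φ₀)} × ⋯ × A_{(K,Φₙ)}` of CM abelian varieties with CM types drawn from
`K` satisfies the Hodge conjecture in `lefModel` (all degrees); (ii) `[K:ℚ] ≤ 4`.
(ii) ⇒ (i) is `lef_hc_cmProd_of_finrank_le_four` (this file); (i) ⇒ (ii) is the corner product of a face
(`exists_face`, gen 5) read through gen 6's unbalanced Weil class. -/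
theorem lef_hc_cmProd_iff_finrank_le_four (K : CMField) :
    (∀ (n : ℕ) (Φ : Fin (n + 1) → CMType K), lefModel.HC (lefModel.cmProd K Φ)) ↔
      Module.finrank ℚ K ≤ 4 := by
  refine ⟨fun h => ?_, fun hK n Φ => lef_hc_cmProd_of_finrank_le_four K hK Φ⟩
  by_contra hK
  obtain ⟨Φ, hΦ⟩ := exists_not_lef_hc_cmProd K (by omega)
  exact hΦ (h 3 Φ)

/-- the same boundary for the four-fold products alone: all `P = A_{Φ₁} × ⋯ × A_{Φ₄}` over `K` satisfy HC in
`lefModel` iff `[K:ℚ] ≤ 4` -/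
theorem lef_hc_PP_iff_finrank_le_four (K : CMField) :
    (∀ Φ : Fin 4 → CMType K, lefModel.HC (PP K Φ)) ↔ Module.finrank ℚ K ≤ 4 := by
  refine ⟨fun h => ?_, fun hK Φ => ?_⟩
  · by_contra hK
    obtain ⟨f⟩ := exists_face K (six_le_finrank_of_four_lt K (by omega))
    exact not_lef_hc_PP_face K f (by omega) (h f.corner)
  · exact lef_hc_of_presented_of_finrank_le_four K hK _ (presented_cmProd K exteriorHodgeData Φ)

end Boundary

/-! ### 11. CM types induced from one field of degree at most four -/

section Induced

variable {K F : CMField}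

/-- the CM type of `F` **induced** from a CM type `Ψ` of `K` along `e : K →+* F`: the embeddings of `F` whose
restriction along `e` lies in `Ψ` (for `[F:K] = d` this is the type of `A_{(K,Ψ)}^d`-like, "degenerate", CM
abelian varieties with CM by `F`, e.g. `E^g` with `E` a CM elliptic curve) -/
def induceType (e : K →+* F) (Ψ : CMType K) : CMType F :=
  ⟨{τ | τ.comp e ∈ Ψ.1}, fun τ => Ψ.2 (τ.comp e)⟩

/-- membership in the induced CM type: `τ ∈ induceType e Ψ` iff `τ ∘ e ∈ Ψ` (definitional) -/
theorem mem_induceType_iff (e : K →+* F) (Ψ : CMType K) (τ : F →+* ℂ) :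
    τ ∈ (induceType e Ψ).1 ↔ τ.comp e ∈ Ψ.1 := Iff.rfl

variable (K) in
/-- `A_{(F, induced type)}` is presented over `K` -/
theorem presented_cmObj_induceType (e : K →+* F) (Ψ : CMType K) : (cmObj F (induceType e Ψ)).Presented K :=
  ⟨fun _ => Ψ, fun _ => (eK F : F →+* FK F).comp e, fun _ _ => Iff.rfl⟩

/-- the iterated product of `lefModel` is that of the exterior model -/
theorem lefModel_prodFin : ∀ (n : ℕ) (X : Fin (n + 1) → Obj), lefModel.prodFin n X = EM.prodFin n X
  | 0, _ => rfl
  | n + 1, X => by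
    rw [Universe.prodFin, Universe.prodFin, lefModel_prodFin n]
    rfl

/-- **HC in the Lefschetz model for every product of CM abelian varieties `A_{(F₀,Φ₀)} × ⋯ × A_{(Fₙ,Φₙ)}` whose
CM types are all induced from CM types of ONE CM field `K` of degree `≤ 4`** along embeddings
`eᵢ : K →+* Fᵢ` — the CM fields `Fᵢ ⊇ K` and the dimensions `[Fᵢ:ℚ]/2` are arbitrary (e.g. every product of
CM abelian varieties of `E^g`-type for one imaginary quadratic `k = End⁰(E)`, in any dimensions). -/
theorem lef_hc_prodFin_induceType (K : CMField) (hK : Module.finrank ℚ K ≤ 4) {n : ℕ}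
    (F : Fin (n + 1) → CMField) (e : ∀ i, K →+* F i) (Ψ : Fin (n + 1) → CMType K) :
    lefModel.HC (lefModel.prodFin n fun i => cmObj (F i) (induceType (e i) (Ψ i))) := by
  rw [lefModel_prodFin]
  exact lef_hc_of_presented_of_finrank_le_four K hK _
    (presented_prodFin K exteriorHodgeData n _ fun i => presented_cmObj_induceType K (e i) (Ψ i))

/-- in particular a single `A_{(F,Φ)}` of any dimension whose CM type is induced from a CM field of degree `≤ 4` -/
theorem lef_hc_cmObj_induceType (K : CMField) (hK : Module.finrank ℚ K ≤ 4) (e : K →+* F) (Ψ : CMType K) :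
    lefModel.HC (cmObj F (induceType e Ψ)) :=
  lef_hc_of_presented_of_finrank_le_four K hK _ (presented_cmObj_induceType K e Ψ)

end Induced

end HodgeCM.Toy

end
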